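import Literature.MathematicalPhysics.QuantumFieldTheory.Balaban1985CMP102.Theorems
import Literature.MathematicalPhysics.QuantumFieldTheory.Balaban1983to89.B10StarLower
import Summits.QuantumFields.Balaban3D.Proofs.ScalesArithmetic
import Summits.QuantumFields.Balaban3D.Proofs.Constants

/-!
# Bałaban CMP 102 (1985), d = 3 lane — `Proofs.UVStability3D`: THE END THEOREM (PLAN §0.5 E4) in binder-parametric form —
# Theorem 1 (compact-coupling-window reading) ∧ Theorem 2 for the CONCRETE d = 3 lattice approximations, from the analytic
# leaves of Sects. A/C as named hypotheses, with the thirteen arithmetic leaf obligations DISCHARGED; and the literal-reading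
# negative edge for the same family

Source: T. Bałaban, *Ultraviolet stability of three-dimensional lattice pure gauge field theories*, Commun. Math. Phys. **102**
(1985) 255–275 [Balaban1985UV3] ([B10]; `paper:balaban1985-cmp102-uv-stability-3d`; PDF page = journal page − 254).  Lane
`pub-balaban3d`, seat p3 (PLAN §3.1 p3, as landed: «`Proofs/UVStability3D.lean`: `uvStability3D_compact_all` = `thm1Compact_and_thm2_of_leafSystem`
on the concrete leaf system with the E3 leaves as hypotheses — lands EARLY as a binder-parametric theorem and loses hypotheses as
p4–p6 discharge leaves; plus the literal-reading negative edge for `run3` from `not_thm1Printed_of_leafSystems`»).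

THE PRINTED STATEMENTS (p. 257 = PDF 3 L4–7): «Theorem 1. The lattice approximations of the three-dimensional pure Yang–Mills
theory with a semi-simple compact group Lie G are ultraviolet stable in the sense that the sequence of densities ρ_k, constructed
by the inductive definition (2), with ρ₀ given by (1), satisfies the bounds (5).» with p. 257 L1–2 «and the constant O(1) is
independent of ε, k, g_k in a bounded set.»; p. 272 = PDF 18 L35–37: «Theorem 2. The sequence of densities ρ_k defined by the
inductive equations (2), with ρ₀ given by (1), satisfies the inequalities (41), (47).»

ARCHITECTURE.  The 4D cell certified the paper's Sect. D assembly over ABSTRACT carriers: `B10Assembly.thm1Compact_and_thm2_of_leafSystem :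
(∀ i, LeafSystem C (T i)) → B10.Thm1PrintedCompact (fun i => (T i).toRunData) ∧ B10.Thm2Printed (…)` (25 named leaf fields per
run, LEAF CENSUS in `B10Assembly`).  For the CONCRETE lattice approximations of the spine (`Setting.Scales L`: torus `T_ε` with
`2L^{m+K}` sites per direction, spacing `ε`, `K` steps with `L^Kε = ε₀`, coupling `g`; run objects `Setting.RunObjects`/
`Theorems.Construction`) this file:
* §1 splits `LeafSystem` into (a) the ARITHMETIC of p. 256 — `g_eq`, `sites_eq`, `scale_le_one`, `g_le_one`, `starT_nonneg`,
  `starT_le`, `rem_eq`, `Rm_zero`, `Rm_succ_le`, and the data `ε`, `Tε`, `ε_pos`, `Tε_nonneg` — DISCHARGED here from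
  `Proofs.ScalesArithmetic` in the normalised units of lane rulings R-NORM/R-CONST (`Consts.g = 1`, `LeafSystem.ε = g₀² = g²ε`
  (1) p. 256, `LeafSystem.Tε = g⁶|T_ε|`; `Constants.NormalisedConsts`, instance `Constants.consts3`), using the spine's field
  `Scales.gK_le_one : g²ε₀ ≤ 1` (g_K ≤ 1: p. 256 L16–17 «ε₀ is a positive constant depending on the coupling constant g only»,
  p. 267 L7–8 / p. 273 «for g_{k−1} / g_j sufficiently small»; ruling R-EPS0),
  and (b) the bundle `ConcreteLeaves C S T` = the ANALYTIC leaves of Sects. A/C/D exactly as typed by the 4D cell (`spec`, `step0`,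
  `noInt0`, the fourteen `StepLeaves` per step, `bound46` (46), `logZT_le`/`PprT_le` (65), `lf` (67)–(71)+[9]§3.C), the two
  group-constant bounds (`logσ₀_le`, `dg_le`: σ₀ of (18) p. 260, d(𝔤) of (22) p. 261), `Λvol_nonneg`, `par`, plus the
  CONCRETENESS EQUATIONS tying the tower carrier and its step pieces to the spine's numbers (`K_eq`, `g_eq`, `sites_eq`, `Rm_eq`,
  `starT_eq` = the star count of `B10StarCount` on the concrete torus, `rem_eq`) — every one of which is `rfl`/one line for a
  tower carrier DEFINED as in STATUS P3-F1 (b) (spine `SectB.toTowerRun`, carrier seat p1).  `leafSystem_of_concrete` rebuilds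
  the 4D cell's `LeafSystem` from (b).
* §2 THE END THEOREM, binder-parametric (`uvStability3D_compact_family`, `uvStability3D_compact_all`): for a construction `mk`, any
  tower carriers over its run objects (`(tower G 𝔊 S).toRunData = (mk G 𝔊 S).toRunData`) carrying `ConcreteLeaves`, and any
  family `ι : I → Scales L` of approximations: `B10.Thm1PrintedCompact ∧ B10.Thm2Printed` for
  `fun i => (mk G 𝔊 (ι i)).toRunData` (`uvStability3D_compact_family/_subfamily`), and for `ι = id` the family of ALL `Scales L`
  (`uvStability3D_compact_all`; `Scales.gK_le_one` = the cell's normalisation of «ε₀ depending on g only», R-EPS0, supplies g_k ≤ 1).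
* §4 THE SAME TWO STATEMENTS IN THE SHAPE OF RULING R-EPS0′ (`Theorems` v3: «∃ eps0 : ℝ → ℝ, …» over the family
  `{S // S.ε₀ = eps0 S.g}` — p. 256 L15–18 «ε₀ … depending on the coupling constant g only»): `uvStability3D_compact_eps0` EXHIBITS
  `eps0 := Constants.eps0Of γ₀` (= (min γ₀ 1)²/g², so g_k ≤ γ₀ := the minimum of the leaf seats' thresholds, for all k ≤ K) and
  needs the concrete leaf bundles only on that family; **`uvStability3D_asPrinted : … → Theorems.Thm1AsPrintedCompact mk ∧
  Theorems.Thm2AsPrintedC mk`** is the spine-by-name form (PLAN §0.5 E4); `not_thm1Printed_eps0`/`compact_not_literal_eps0` the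
  negative edge there.
* THE NEGATIVE EDGE for the same concrete families lives in the sibling `Proofs.NegativeEdge` (`not_thm1Printed_concrete`,
  `not_thm1Printed_all`, `not_thm1Printed_eps0`, `compact_not_literal_eps0`):
  the literal reading `B10.Thm1Printed` FAILS whenever the family contains approximations with arbitrarily small bare coupling
  g₀² = g²ε (ALL of `Scales L` does: `scales_fine`), the
  group has `d(𝔤) ≥ d₀ > 0` and the unit configuration is a level-0 configuration with zero action (reader's items (R1), (R3) of
  `B10DagLeaf`; (R2) is DISCHARGED by the concrete star count `(7/4)|T₁^{(k)}| ≤ |T₁^{(k)*}|` via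
  `B10StarLower.not_thm1Printed_of_concreteStar_fineLattices`) — PLAN §0.4, cell pub-balaban GAPS G-B10-01.
HYPOTHESIS LEDGER of the end theorem (PLAN §0.5 E4 / §2.3; each to shrink by follow-up theorems, never by editing this file):
the fields of `ConcreteLeaves` marked ANALYTIC below are the E3 leaves (owners p4: `step0`, `steps k .bound55/.bound55Lower`;
p5: `.cumulant58/.cumulantLower/.oldOutside/.ztermSucc`, `PprT_le`; p6: `.repr33_60/.decomp35_61/.norm35/.vacuumWhole/.rmSucc`,
`logZT_le`; p2: `bound46`, `lf`; p1: the carrier equations, `spec`, `noInt0`, `Λvol_nonneg`, `par`, `.starCount/.pintSucc/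
.estep62` of the concrete pieces), which the lane proves from the printed inputs b5, b6, b7, b8 (`B8LeafR`), b9 (`B9LeafX`), b11
(`B11Leaf`), [B1] (3.24), [B2] §3.C.
HONEST FRAMING (PLAN §0): a kernel certificate that the concrete d = 3 objects of the spine meet the 4D cell's assembly with the
arithmetic done; NOT a proof of any analytic leaf, NOT a continuum statement, nothing about the Millennium problem.  No `sorry`,
no new axiom; every analytic input is an explicit structure field.
-/

namespace Summit.QuantumFields.Balaban3D.Proofs.UVStability3D

open Literature.MathematicalPhysics.QuantumFieldTheory.Balaban1983to89
open Literature.MathematicalPhysics.QuantumFieldTheory.Balaban1983to89.B10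
open Literature.MathematicalPhysics.QuantumFieldTheory.Balaban1983to89.B10SectAGathering
open Literature.MathematicalPhysics.QuantumFieldTheory.Balaban1985CMP102.Setting
open Literature.MathematicalPhysics.QuantumFieldTheory.Balaban1985CMP102.Theorems
open Summit.QuantumFields.Balaban3D.Proofs.ScalesArithmetic
open Summit.QuantumFields.Balaban3D.Proofs.Constants

variable {L : ℕ}

/-! ## §1 The concrete leaf bundle and the reconstruction of the 4D cell's `LeafSystem` -/

/-- **THE CARRIER EQUATIONS of one lattice approximation** `S : Scales L` carried by a tower carrier `T : B10.TowerRun` with the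
family constants `C` (group (i) below; groups (ii)–(iii) form `AnalyticLeaves`; together `ConcreteLeaves` = what remains of the 4D
cell's `B10Assembly.LeafSystem C T` (25 fields, LEAF CENSUS there) once the arithmetic of p. 256 is discharged by
`Proofs.ScalesArithmetic`).  Three groups of fields:
(i) CONCRETENESS OF THE CARRIER — `K_eq`, `g_eq`, `sites_eq` (the tower's `K`, `g_k`, `|T₁^{(k)}|` are the spine's `S.K`, `S.gk`,
`S.sites`: «g_k = g(L^kε)^{1/2}», «|T₁^{(k)}| = (L^kε)^{−3}|T_ε|» p. 256 L39), `par` (the run uses the family's `M₁, b₀, p₀` of (7)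
p. 257), `Rm_eq` (the remainder term of (41)/(47) «Σ_{j=0}^{k−1} O((L^jε)^{3+κ₀})|T₁^{(j)}|» p. 266 L21 IS the sum of the step units
with coefficient `rstar`, in g_k-units `(g_j²)^{3+κ₀}|T₁^{(j)}|`), `Λvol_nonneg` (|Λ_k| ≥ 0);
(ii) CONCRETENESS OF THE STEP PIECES — `starT_eq` (the piece `|T₁^{(k)*}|` of (62) p. 271 IS the star count of p. 260 on the
concrete torus: `B10StarCount.starCount univ` at level `k + 1` of `S.P`), `rem_eq` (the remainder unit is `(g_k²)^{3+κ₀}|T₁^{(k)}|`,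
p. 269 L24), `logσ₀_le`, `dg_le` (σ₀ of (18) p. 260 and d(𝔤) of (22) p. 261 are constants of the ONE group: `|log σ₀| ≤ σmax`,
`d(𝔤) ≤ dg`);
(iii) THE ANALYTIC LEAVES (E3 of PLAN §0.5; HYPOTHESES until the leaf seats discharge them): `spec` (binding of the (41)/(47)
slot), `step0` ((1) p. 256 at k = 0), `noInt0` ((43): no interaction at k = 0), `steps` (the fourteen step leaves of Sect. A /
Sect. C for every k < K: (22)/(55), (24)/(58)–(59), (33)/(60), vacuum sum, (35)/(61), star count, p. 272 old terms, (36)/(41),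
(62), Z-term and remainder rates), `bound46` ((46) p. 267), `logZT_le`, `PprT_le` ((65) p. 273 inputs), `lf` ((67)–(71) + [9]
§3.C, pp. 273–274).
Only NAMES hypotheses and equations; nothing of the paper is asserted. [cite: Balaban1985UV3, pp.256–274] -/
structure CarrierEqs (C : B10Assembly.Consts) (S : Scales L) (T : TowerRun) : Prop where
  /-- (i) the tower has the spine's number of steps `K` («L^Kε = ε₀» p. 256 L18) -/
  K_eq : T.K = S.K
  /-- (i) the tower's couplings are «g_k = g(L^kε)^{1/2}» p. 256 L39 -/
  g_eq : ∀ k, T.g k = S.gk k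
  /-- (i) the tower's site numbers are «|T₁^{(k)}| = (L^kε)^{−3}|T_ε|» p. 256 L39 -/
  sites_eq : ∀ k, T.sites k = S.sites k
  /-- (i) the run uses the family's `M₁, b₀, p₀` ((7) p. 257) -/
  par : T.M₁ = C.M₁ ∧ T.b₀ = C.b₀ ∧ T.p₀ = C.p₀
  /-- (i) the remainder term of (41)_k is `rstar·Σ_{j<k}(g_j²)^{3+κ₀}|T₁^{(j)}|` (p. 266 L21, g_k-units) -/
  Rm_eq : ∀ k, T.Rm k = C.rstar * ∑ j ∈ Finset.range k, (S.gk j ^ 2) ^ (3 + C.κ₀) * S.sites j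
  /-- (i) |Λ_k| ≥ 0 -/
  Λvol_nonneg : ∀ (k : ℕ) (h : T.Hist k), 0 ≤ T.Λvol k h
  /-- (i) binding of the abstract slot «ρ_k satisfies (41), (47)» (spine `SectB.TowerObjects.specOK_pin`) -/
  spec : SpecOK T

/-- **THE ANALYTIC LEAVES of one lattice approximation** over its tower carrier (E3 of PLAN §0.5; HYPOTHESES until the leaf seats
discharge them) together with the concreteness equations of the STEP PIECES: `step0` ((1) p. 256 at k = 0), `noInt0` ((43): no
interaction at k = 0), `steps` (the fourteen step leaves of Sect. A / Sect. C for every k < K: (22)/(55), (24)/(58)–(59),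
(33)/(60), vacuum sum, (35)/(61), star count, p. 272 old terms, (36)/(41), (62), Z-term and remainder rates), `bound46` ((46)
p. 267), `logZT_le`, `PprT_le` ((65) p. 273 inputs), `lf` ((67)–(71) + [9] §3.C, pp. 273–274); pieces: `starT_eq` (the piece
`|T₁^{(k)*}|` of (62) p. 271 IS the star count of p. 260 on the concrete torus: `B10StarCount.starCount univ` at level `k + 1` of
`S.P`), `rem_eq` (the remainder unit is `(g_k²)^{3+κ₀}|T₁^{(k)}|`, p. 269 L24), `logσ₀_le`, `dg_le` (σ₀ of (18) p. 260 and d(𝔤) of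
(22) p. 261 are constants of the ONE group: `|log σ₀| ≤ σmax`, `d(𝔤) ≤ dg`).  Only NAMES hypotheses; nothing asserted.
[cite: Balaban1985UV3, pp.256–274] -/
structure AnalyticLeaves (C : B10Assembly.Consts) (S : Scales L) (T : TowerRun) where
  /-- ANALYTIC (owner p4/p1): (1) p. 256 at k = 0 is (41)₀ ∧ (47)₀ -/
  step0 : Step0Printed T
  /-- ANALYTIC (owner p1): no interaction terms at k = 0 ((43) p. 266: the sum starts at j = 1) -/
  noInt0 : B10LargeField.NoInteraction0 T
  /-- ANALYTIC (owners p4–p6): the fourteen step leaves of Sect. A (k = 0) / Sect. C (k ≥ 1), every k < K -/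
  steps : ∀ k, k + 1 ≤ T.K → StepLeaves T k
  /-- ANALYTIC (owner p2): (46) p. 267 L12 with the family's O(1) = `C46` -/
  bound46 : ∀ k, 1 ≤ k → k ≤ T.K → ∀ (h : T.Hist k) (U : T.Cfg k),
    |T.Pint k h U| ≤ C.C46 * T.M₁ ^ 3 * ((T.g (k - 1)) ^ 2 * (pFun T.b₀ T.p₀ (T.g (k - 1))) ^ 2) * T.Λvol k h
  /-- ANALYTIC (owner p6): |log Z^{(k)}(T₁^{(k)}, 1)| ≤ z|T₁^{(k)}| (p. 273, implicit in «we get easily») -/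
  logZT_le : ∀ (k : ℕ) (hk : k + 1 ≤ T.K), |(steps k hk).P.logZT| ≤ C.z * T.sites k
  /-- ANALYTIC (owner p5): |Σ_X 𝒫′_{k+1}(g_k, X, 1)| ≤ aP|T₁^{(k)}| (p. 273 from (25)) -/
  PprT_le : ∀ (k : ℕ) (hk : k + 1 ≤ T.K), |(steps k hk).P.PprT| ≤ C.aP * T.sites k
  /-- ANALYTIC (owner p2): the large-field control of pp. 273–274 ((67)–(71) + [9] §3.C), constant `d` -/
  lf : ∀ k, k ≤ T.K → ∀ U : T.Cfg k,
    T.LF k U (fun h => -(T.mainT k h U) + T.Zterm k h) ≤ Real.exp (C.d * T.sites k)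
  /-- PIECES: |T₁^{(k)*}| of (62) IS the concrete star count of p. 260 (coarse level `k + 1` of `S.P`) -/
  starT_eq : ∀ (k : ℕ) (hk : k + 1 ≤ T.K),
    (steps k hk).P.starT = (B10StarCount.starCount (Finset.univ : Finset (Site S.P (k + 1))) : ℝ)
  /-- PIECES: |log σ₀| ≤ σmax (σ₀ = σ(0) of (18) p. 260, one group for the family) -/
  logσ₀_le : ∀ (k : ℕ) (hk : k + 1 ≤ T.K), |(steps k hk).P.logσ₀| ≤ C.σmax
  /-- PIECES: d(𝔤) ≤ dg ((22) p. 261 «d(𝔤) denotes a dimension of the Lie algebra 𝔤», one group for the family) -/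
  dg_le : ∀ (k : ℕ) (hk : k + 1 ≤ T.K), (steps k hk).P.dg ≤ C.dg
  /-- PIECES: the remainder unit of step k is `(g_k²)^{3+κ₀}|T₁^{(k)}|` (p. 269 L24, g_k-units) -/
  rem_eq : ∀ (k : ℕ) (hk : k + 1 ≤ T.K), (steps k hk).P.rem = (S.gk k ^ 2) ^ (3 + C.κ₀) * S.sites k

/-- **THE CONCRETE LEAF BUNDLE** = carrier equations (`CarrierEqs`: rfl-level for a tower built per rulings R-PIECES/R-E/R-CONST over
the spine's `SectB.TowerObjects`, see `Proofs.EndTheorem`) + analytic leaves and piece equations (`AnalyticLeaves`): what remains of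
the 4D cell's `B10Assembly.LeafSystem C T` (25 fields) once the arithmetic of p. 256 is discharged by `Proofs.ScalesArithmetic`.
[cite: Balaban1985UV3, pp.256–274] -/
structure ConcreteLeaves (C : B10Assembly.Consts) (S : Scales L) (T : TowerRun)
    extends CarrierEqs C S T, AnalyticLeaves C S T

namespace ConcreteLeaves

variable {C : B10Assembly.Consts} {S : Scales L} {T : TowerRun}

/-- DICTIONARY (R-NORM) in the shape of the 4D cell's hypotheses `hgk : T.g k = gRun g L ε k` (with `g := 1`, `ε := g₀²`):
for use with `B10Assembly.cumulant58_of_raw` / `repr33_60_of_raw` / `decomp35_61_of_raw` / `cumulantLower_of_raw` /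
`vacuumWhole_of_raw` / `largeLoc_run_le` by the leaf seats. [cite: Balaban1985UV3, (5) p.256] -/
theorem g_eq_norm (X : ConcreteLeaves C S T) (k : ℕ) : T.g k = gRun 1 (L : ℝ) S.g0sq k := by
  rw [X.g_eq]; exact gk_eq_gRun_norm S k

/-- DICTIONARY (R-NORM) in the shape of the 4D cell's `hrem : P.rem = (L ^ k * ε) ^ (3 + κ₀) * T.sites k` (`ε := g₀²`).
[cite: Balaban1985UV3, p.262 + p.269] -/
theorem rem_eq_norm (X : ConcreteLeaves C S T) (k : ℕ) (hk : k + 1 ≤ T.K) :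
    (X.steps k hk).P.rem = ((L : ℝ) ^ k * S.g0sq) ^ (3 + C.κ₀) * T.sites k := by
  rw [X.rem_eq, X.sites_eq, norm_rem_eq]

/-- DICTIONARY: `|T₁^{(k)}| = sitesRun L g₀² (g⁶|T_ε|) k` on the tower. [cite: Balaban1985UV3, (5) p.256] -/
theorem sites_eq_norm (X : ConcreteLeaves C S T) (k : ℕ) : T.sites k = sitesRun (L : ℝ) S.g0sq (S.g ^ 6 * S.volT) k := by
  rw [X.sites_eq]; exact sites_eq_sitesRun_norm S k

/-- `0 < g_k` on the tower. [folklore] -/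
theorem g_pos (X : ConcreteLeaves C S T) (k : ℕ) : 0 < T.g k := by
  rw [X.g_eq]; exact gk_pos S k

/-- `g_k ≤ 1` for `k ≤ K` on the tower (`Scales.gK_le_one`) — the 4D cell's standing `hgk1 : T.g k ≤ 1`. [cite: Balaban1985UV3, p.256 + p.267] -/
theorem g_le_one (X : ConcreteLeaves C S T) (k : ℕ) (hk : k ≤ T.K) : T.g k ≤ 1 := by
  rw [X.g_eq]; exact gk_le_one S S.gK_le_one k (by have := X.K_eq; omega)

/-- `|T₁^{(k)}| = #T^{(k)}` on the tower, `k ≤ K` (the site count of the concrete torus). [cite: Balaban1985UV3, (5) p.256] -/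
theorem sites_eq_card (X : ConcreteLeaves C S T) (k : ℕ) (hk : k ≤ T.K) : T.sites k = Fintype.card (Site S.P k) := by
  rw [X.sites_eq]; exact ScalesArithmetic.sites_eq_card S k (by have := X.K_eq; omega)

end ConcreteLeaves

/-- **THE 4D CELL'S LEAF SYSTEM REBUILT FROM THE CONCRETE BUNDLE** — the thirteen arithmetic fields discharged: `ε := g₀² = g²ε`,
`Tε := g⁶|T_ε|` (normalised units), `g_eq`/`sites_eq` by `ScalesArithmetic.gk_eq_gRun_norm`/`sites_eq_sitesRun_norm`,
`scale_le_one`/`g_le_one` by `norm_scale_le_one`/`gk_le_one` from `Scales.gK_le_one : g²ε₀ ≤ 1`, `starT_nonneg`/`starT_le` by the concrete count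
(`starCount_univ_nonneg`, `starCount_univ_le_three_sites`), `rem_eq` by `norm_rem_eq`, `Rm_zero`/`Rm_succ_le` (with EQUALITY) from
`Rm_eq`.  Kernel bookkeeping; nothing asserted. [cite: Balaban1985UV3, pp.256–274] -/
noncomputable def leafSystem_of_concrete {C : B10Assembly.Consts} {S : Scales L} {T : TowerRun} (hC : NormalisedConsts L C)
    (X : ConcreteLeaves C S T) : B10Assembly.LeafSystem C T where
  ε := S.g0sq
  Tε := S.g ^ 6 * S.volT
  ε_pos := g0sq_pos S
  Tε_nonneg := normVol_nonneg S
  g_eq k := by rw [X.g_eq, hC.1, hC.2]; exact gk_eq_gRun_norm S k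
  sites_eq k := by rw [X.sites_eq, hC.2]; exact sites_eq_sitesRun_norm S k
  scale_le_one k hk := by
    rw [hC.2]
    exact norm_scale_le_one S S.gK_le_one k (by have := X.K_eq; omega)
  g_le_one k hk := by
    rw [X.g_eq]
    exact gk_le_one S S.gK_le_one k (by have := X.K_eq; omega)
  par := X.par
  spec := X.spec
  step0 := X.step0
  noInt0 := X.noInt0
  steps := X.steps
  Λvol_nonneg := X.Λvol_nonneg
  bound46 := X.bound46
  starT_nonneg k hk := by
    rw [X.starT_eq]
    exact starCount_univ_nonneg S k (by have := X.K_eq; omega)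
  starT_le k hk := by
    rw [X.starT_eq, X.sites_eq]
    exact starCount_univ_le_three_sites S k (by have := X.K_eq; omega)
  logσ₀_le := X.logσ₀_le
  dg_le := X.dg_le
  logZT_le := X.logZT_le
  PprT_le := X.PprT_le
  rem_eq k hk := by rw [X.rem_eq, hC.2, X.sites_eq, norm_rem_eq]
  Rm_zero := by rw [X.Rm_eq]; simp
  Rm_succ_le k hk := le_of_eq (by
    rw [X.Rm_eq, X.Rm_eq, X.rem_eq, Finset.sum_range_succ, mul_add])
  lf := X.lf

/-! ## §2 The end theorem, binder-parametric -/

/-- **THEOREM 1 (compact reading) ∧ THEOREM 2 FOR A FAMILY OF CONCRETE RUNS** — the 4D cell's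
`B10Assembly.thm1Compact_and_thm2_of_leafSystem` on leaf systems rebuilt from concrete bundles, transported to any run-data
family `D` the towers project to: for towers `T i` over `D i` (`(T i).toRunData = D i`) of lattice approximations `S i : Scales L`
carrying `ConcreteLeaves C (S i) (T i)` for normalised family constants `C`: `B10.Thm1PrintedCompact D ∧ B10.Thm2Printed D`, with the
O(1) of (5) the 4D cell's displayed `B10Assembly.O1 C gmin gmax` (independent of ε, k, the run and the bare coupling).
[cite: Balaban1985UV3, Thm 1 p.257 + Thm 2 p.272] -/
theorem uvStability3D_compact_family {I : Type} (C : B10Assembly.Consts) (hC : NormalisedConsts L C)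
    (D : I → RunData) (S : I → Scales L) (T : I → TowerRun)
    (hT : ∀ i, (T i).toRunData = D i) (X : ∀ i, ConcreteLeaves C (S i) (T i)) :
    Thm1PrintedCompact D ∧ Thm2Printed D := by
  have hfun : (fun i => (T i).toRunData) = D := funext hT
  have h := B10Assembly.thm1Compact_and_thm2_of_leafSystem T (fun i => leafSystem_of_concrete hC (X i))
  rw [hfun] at h
  exact h

/-- **THE END THEOREM ON THE FAMILY OF ALL LATTICE APPROXIMATIONS** (the reading of `Theorems` v2, kept for record): for a
construction `mk` of the run objects, tower carriers over it (`(tower G 𝔊 S).toRunData = (mk G 𝔊 S).toRunData` — spine `SectB`: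
`TowerObjects.toTowerRun`, `rfl`) carrying concrete leaf bundles with normalised family constants `C` for EVERY `S : Scales L`:
`B10.Thm1PrintedCompact ∧ B10.Thm2Printed` on `fun S : Scales L => (mk G 𝔊 S).toRunData`, every group as printed.  (The spine's
v3 statements quantify `∃ eps0` and restrict to `Family L eps0`; see §4 `uvStability3D_asPrinted`.) [cite: Balaban1985UV3, Thm 1 p.257 + Thm 2 p.272] -/
theorem uvStability3D_compact_all (mk : Construction L) (C : B10Assembly.Consts) (hC : NormalisedConsts L C)
    (tower : ∀ (G : Type) [GaugeGroup G] [MeasurableSpace G] [HaarData G], GroupModel G → Scales L → TowerRun)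
    (hT : ∀ (G : Type) [GaugeGroup G] [MeasurableSpace G] [HaarData G] (𝔊 : GroupModel G) (S : Scales L),
      (tower G 𝔊 S).toRunData = (mk G 𝔊 S).toRunData)
    (X : ∀ (G : Type) [GaugeGroup G] [MeasurableSpace G] [HaarData G] (𝔊 : GroupModel G) (S : Scales L),
      ConcreteLeaves C S (tower G 𝔊 S))
    (G : Type) [GaugeGroup G] [MeasurableSpace G] [HaarData G] (𝔊 : GroupModel G) :
    Thm1PrintedCompact (fun S : Scales L => (mk G 𝔊 S).toRunData)
      ∧ Thm2Printed (fun S : Scales L => (mk G 𝔊 S).toRunData) :=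
  uvStability3D_compact_family C hC (fun S => (mk G 𝔊 S).toRunData) (fun S => S) (fun S => tower G 𝔊 S)
    (fun S => hT G 𝔊 S) (X G 𝔊)

/-- The same for a SUB-FAMILY `ι : I → Scales L` (e.g. one coupling, one ε₀: the family of (3) p. 256 «depending on g and ε₀
only»), when concrete leaf bundles are available only there. [cite: Balaban1985UV3, Thm 1 p.257 + Thm 2 p.272] -/
theorem uvStability3D_compact_subfamily (mk : Construction L) (C : B10Assembly.Consts) (hC : NormalisedConsts L C)
    (tower : ∀ (G : Type) [GaugeGroup G] [MeasurableSpace G] [HaarData G], GroupModel G → Scales L → TowerRun)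
    (hT : ∀ (G : Type) [GaugeGroup G] [MeasurableSpace G] [HaarData G] (𝔊 : GroupModel G) (S : Scales L),
      (tower G 𝔊 S).toRunData = (mk G 𝔊 S).toRunData)
    {I : Type} (ι : I → Scales L)
    (G : Type) [GaugeGroup G] [MeasurableSpace G] [HaarData G] (𝔊 : GroupModel G)
    (X : ∀ i : I, ConcreteLeaves C (ι i) (tower G 𝔊 (ι i))) :
    Thm1PrintedCompact (fun i => (mk G 𝔊 (ι i)).toRunData) ∧ Thm2Printed (fun i => (mk G 𝔊 (ι i)).toRunData) :=
  uvStability3D_compact_family C hC (fun i => (mk G 𝔊 (ι i)).toRunData) ι (fun i => tower G 𝔊 (ι i))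
    (fun i => hT G 𝔊 (ι i)) X

/-! ## §4 The end theorem and the negative edge in the shape of ruling R-EPS0′ («∃ eps0 : ℝ → ℝ», ε₀ = ε₀(g) EXHIBITED) -/

/-- **THE END THEOREM, R-EPS0′ SHAPE** (p. 256 L15–18 «when L^kε = ε₀, where ε₀ is a positive constant depending on the coupling
constant g only» ↦ the spine's «∃ eps0 : ℝ → ℝ, (∀ g > 0, 0 < eps0 g) ∧ …» prefix of `Theorems` v3): for a construction `mk` with
tower carriers carrying concrete leaf bundles ON THE EXHIBITED FAMILY `S.ε₀ = ε₀(S.g)`, `ε₀(g) = (min γ₀ 1)²/g²`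
(`Constants.eps0Of`; there `g_k ≤ γ₀` for all `k ≤ K` by `ScalesArithmetic.gk_le_gamma0_of_eps0Of`, which is what the leaf seats'
smallness premises consume), and EVERY group as printed:
`∃ eps0, (∀ g > 0, 0 < eps0 g) ∧ B10.Thm1PrintedCompact (fun S : {S // S.ε₀ = eps0 S.g} => (mk G 𝔊 S.1).toRunData)
∧ B10.Thm2Printed (same family)` — with the witness `eps0 := eps0Of γ₀`.  Once `Theorems` v3 / `Thm2AsPrintedC` land this is
`Thm1AsPrintedCompact mk ∧ Thm2AsPrintedC mk` by `exact`. [cite: Balaban1985UV3, Thm 1 p.257 + Thm 2 p.272 + (2) p.256] -/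
theorem uvStability3D_compact_eps0 (mk : Construction L) (C : B10Assembly.Consts) (hC : NormalisedConsts L C)
    (tower : ∀ (G : Type) [GaugeGroup G] [MeasurableSpace G] [HaarData G], GroupModel G → Scales L → TowerRun)
    (hT : ∀ (G : Type) [GaugeGroup G] [MeasurableSpace G] [HaarData G] (𝔊 : GroupModel G) (S : Scales L),
      (tower G 𝔊 S).toRunData = (mk G 𝔊 S).toRunData)
    {γ₀ : ℝ} (hγ : 0 < γ₀)
    (X : ∀ (G : Type) [GaugeGroup G] [MeasurableSpace G] [HaarData G] (𝔊 : GroupModel G) (S : Scales L),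
      S.ε₀ = eps0Of γ₀ S.g → ConcreteLeaves C S (tower G 𝔊 S))
    (G : Type) [GaugeGroup G] [MeasurableSpace G] [HaarData G] (𝔊 : GroupModel G) :
    ∃ eps0 : ℝ → ℝ, (∀ g : ℝ, 0 < g → 0 < eps0 g) ∧
      Thm1PrintedCompact (fun S : {S : Scales L // S.ε₀ = eps0 S.g} => (mk G 𝔊 S.1).toRunData) ∧
      Thm2Printed (fun S : {S : Scales L // S.ε₀ = eps0 S.g} => (mk G 𝔊 S.1).toRunData) :=
  ⟨eps0Of γ₀, fun _ hg => eps0Of_pos hγ hg,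
    uvStability3D_compact_subfamily mk C hC tower hT (fun S : {S : Scales L // S.ε₀ = eps0Of γ₀ S.g} => S.1) G 𝔊
      (fun S => X G 𝔊 S.1 S.2)⟩

/-- **THE END THEOREM, SPINE DECLARATIONS BY NAME** (`Theorems` v3, ruling R-EPS0′/R-END): under the hypotheses of
`uvStability3D_compact_eps0` — a construction `mk`, tower carriers over it, normalised family constants, a positive threshold `γ₀`
and concrete leaf bundles on the exhibited family `S.ε₀ = ε₀(S.g)` — **`Theorems.Thm1AsPrintedCompact mk ∧ Theorems.Thm2AsPrintedC mk`**:
Theorem 1 p. 257 (compact-coupling-window reading) and Theorem 2 p. 272, each with its printed family clause «ε₀ … depending on the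
coupling constant g only» witnessed by `eps0 := Constants.eps0Of γ₀`. [cite: Balaban1985UV3, Thm 1 p.257 + Thm 2 p.272 + p.256 L15–18] -/
theorem uvStability3D_asPrinted (mk : Construction L) (C : B10Assembly.Consts) (hC : NormalisedConsts L C)
    (tower : ∀ (G : Type) [GaugeGroup G] [MeasurableSpace G] [HaarData G], GroupModel G → Scales L → TowerRun)
    (hT : ∀ (G : Type) [GaugeGroup G] [MeasurableSpace G] [HaarData G] (𝔊 : GroupModel G) (S : Scales L),
      (tower G 𝔊 S).toRunData = (mk G 𝔊 S).toRunData)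
    {γ₀ : ℝ} (hγ : 0 < γ₀)
    (X : ∀ (G : Type) [GaugeGroup G] [MeasurableSpace G] [HaarData G] (𝔊 : GroupModel G) (S : Scales L),
      S.ε₀ = eps0Of γ₀ S.g → ConcreteLeaves C S (tower G 𝔊 S)) :
    Thm1AsPrintedCompact mk ∧ Thm2AsPrintedC mk := by
  constructor
  · intro G _ _ _ 𝔊
    obtain ⟨eps0, hpos, h1, _⟩ := uvStability3D_compact_eps0 mk C hC tower hT hγ X G 𝔊
    exact ⟨eps0, hpos, h1⟩
  · intro G _ _ _ 𝔊
    obtain ⟨eps0, hpos, _, h2⟩ := uvStability3D_compact_eps0 mk C hC tower hT hγ X G 𝔊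
    exact ⟨eps0, hpos, h2⟩


end Summit.QuantumFields.Balaban3D.Proofs.UVStability3D
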